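import Mathlib.Analysis.SpecialFunctions.Pow.Deriv
import Mathlib.Analysis.SpecialFunctions.Pow.Continuity
import Mathlib.Analysis.Calculus.MeanValue
import Literature.Analysis.Distribution.BoundaryValueLimit
import HarnessLib

/-!
# Weak boundary pairings of holomorphic functions on a strip with an integrable blow-up

For `u` holomorphic on the open strip `S = {0 < im w < 1}` with the growth bound
`‖u(x + iy)‖ ≤ C y^{-p} (1 - y)^{-p} e^{a|x|}` (`0 ≤ p < 1`, `a, C ≥ 0`) and a smooth compactly supported
test function `ψ`, the pairing `Φ(y) = ∫ u(x + iy) ψ(x) dx` satisfies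

* `hasDerivAt_stripPairing` — `Φ'(y) = -i ∫ u(x + iy) ψ'(x) dx` (Cauchy–Riemann and one integration by
  parts; the one-dimensional case of the tree's `Literature.Analysis.Distribution.hasDerivAt_sliceIntegral`,
  Hörmander's (3.1.13));
* `norm_stripPairing_sub_le` — the **rate bound** `‖Φ(y') - Φ(y)‖ ≤ K (y'^{1-p} - y^{1-p})` for
  `0 < y ≤ y' ≤ 1/2`, `K = C 2^p e^{aR} ‖ψ'‖₁ / (1 - p)` (`ψ` supported in `[-R, R]`): the blow-up `y^{-p}`
  is integrable;
* `exists_tendsto_stripPairing` — existence of the weak boundary value `lim_{y → 0⁺} Φ(y)` (Hörmander,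
  *ALPDO I*, Thm. 3.1.15 with `N = 1`, the tree's `tendsto_integral_of_norm_le_inv_pow`), and
  `norm_stripPairing_sub_lim_le` — the rate `‖Φ(y) - lim Φ‖ ≤ K y^{1-p}`.

These are the tools of the weak-boundary-value form of the strip rigidity theorem
(`Literature/Analysis/Complex/StripPositivityRigidity.lean`): the rate is uniform over translates of `ψ`,
which makes mollifications of `u` in `re w` continuous up to the boundary, and it makes finitely many
exceptional boundary points invisible to the weak boundary values.

References: L. Hörmander, *The Analysis of Linear Partial Differential Operators I*, Thm. 3.1.11–3.1.15.
-/

noncomputable section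

namespace Literature.Analysis.Complex

open _root_.Complex Set Filter Metric MeasureTheory
open scoped Topology Real

/-! ### The pairing `y ↦ ∫ u(x + iy) ψ(x) dx` of a holomorphic function on the strip -/

/-- **`d/dy ∫ u(x + iy) ψ(x) dx = -i ∫ u(x + iy) ψ'(x) dx`** for `u` holomorphic on the open strip
`{0 < im < 1}` and a smooth compactly supported `ψ` (Cauchy–Riemann `∂_y u = i ∂_x u` and one integration
by parts; the tree's `Literature.Analysis.Distribution.hasDerivAt_sliceIntegral`, Hörmander's (3.1.13)).
[cite: HormanderALPDO1, Thm 3.1.15 proof] -/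
theorem hasDerivAt_stripPairing {u : ℂ → ℂ}
    (hd : DifferentiableOn ℂ u {w : ℂ | 0 < w.im ∧ w.im < 1})
    {ψ : ℝ → ℂ} (hψ : ContDiff ℝ (⊤ : ℕ∞) ψ) (hψc : HasCompactSupport ψ) {y₀ : ℝ}
    (hy₀ : y₀ ∈ Ioo (0:ℝ) 1) :
    HasDerivAt (fun y : ℝ => ∫ x : ℝ, u (x + y * I) * ψ x)
      (-I * ∫ x : ℝ, u (x + y₀ * I) * deriv ψ x) y₀ := by
  have hU : IsOpen {w : ℂ | 0 < w.im ∧ w.im < 1} :=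
    (isOpen_Ioo (a := (0:ℝ)) (b := 1)).preimage continuous_im
  have key := Literature.Analysis.Distribution.hasDerivAt_sliceIntegral (V := ℝ) (E := ℂ)
    (μ := volume) (J := ofRealCLM) (f := u) hU hd hψ hψc (y := 0) (Y := 1) (a := 0) (b := 1)
    hy₀ (fun x _ s hs => by simpa using hs)
  have e1 : (fun s : ℝ => ∫ x : ℝ, ψ x * u (ofRealCLM x + I • ofRealCLM ((0:ℝ) + s • (1:ℝ)))) =
      fun y : ℝ => ∫ x : ℝ, u (x + y * I) * ψ x := by
    funext s; congr 1; funext x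
    simp only [ofRealCLM_apply, zero_add, smul_eq_mul, mul_one]; ring_nf
  have e2 : (-I * ∫ x : ℝ, Literature.Analysis.Distribution.dirDeriv 1 ψ x *
      u (ofRealCLM x + I • ofRealCLM ((0:ℝ) + y₀ • (1:ℝ)))) =
      -I * ∫ x : ℝ, u (x + y₀ * I) * deriv ψ x := by
    congr 1; congr 1; funext x
    simp only [Literature.Analysis.Distribution.dirDeriv, ofRealCLM_apply, zero_add, smul_eq_mul,
      mul_one, fderiv_apply_one_eq_deriv]; ring_nf
  rw [e1, e2] at key
  exact key

/-- Continuity of `y ↦ ∫ u(x + iy) ψ(x) dx` on `(0, 1)`. [folklore] -/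
theorem continuousOn_stripPairing {u : ℂ → ℂ}
    (hd : DifferentiableOn ℂ u {w : ℂ | 0 < w.im ∧ w.im < 1})
    {ψ : ℝ → ℂ} (hψ : ContDiff ℝ (⊤ : ℕ∞) ψ) (hψc : HasCompactSupport ψ) :
    ContinuousOn (fun y : ℝ => ∫ x : ℝ, u (x + y * I) * ψ x) (Ioo 0 1) :=
  fun _ hy => (hasDerivAt_stripPairing hd hψ hψc hy).continuousAt.continuousWithinAt

/-- The growth bound `‖u‖ ≤ C y^{-p} (1-y)^{-p} e^{a|x|}` on the lower half `0 < y ≤ 1/2` of the strip,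
over `|x| ≤ R`: `‖u(x + iy)‖ ≤ C 2^p e^{aR} y^{-p}`. [folklore] -/
theorem norm_le_of_strip_growth_lower {u : ℂ → ℂ} {C a p R : ℝ} (hC : 0 ≤ C) (ha : 0 ≤ a)
    (hp : 0 ≤ p)
    (hb : ∀ w : ℂ, 0 < w.im → w.im < 1 →
      ‖u w‖ ≤ C * w.im ^ (-p) * (1 - w.im) ^ (-p) * Real.exp (a * |w.re|))
    {w : ℂ} (hw0 : 0 < w.im) (hw1 : w.im ≤ 1 / 2) (hwR : |w.re| ≤ R) :
    ‖u w‖ ≤ C * 2 ^ p * Real.exp (a * R) * w.im ^ (-p) := by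
  have h1 : (1 - w.im) ^ (-p) ≤ (2:ℝ) ^ p := by
    rw [Real.rpow_neg (by linarith), ← Real.inv_rpow (by linarith)]
    exact Real.rpow_le_rpow (by rw [inv_nonneg]; linarith)
      (by rw [inv_le_comm₀ (by linarith) (by norm_num)]; linarith) hp
  have h2 : Real.exp (a * |w.re|) ≤ Real.exp (a * R) :=
    Real.exp_le_exp.mpr (mul_le_mul_of_nonneg_left hwR ha)
  have h3 : 0 ≤ w.im ^ (-p) := Real.rpow_nonneg hw0.le _
  calc ‖u w‖ ≤ C * w.im ^ (-p) * (1 - w.im) ^ (-p) * Real.exp (a * |w.re|) := hb w hw0 (by linarith)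
    _ ≤ C * w.im ^ (-p) * (2:ℝ) ^ p * Real.exp (a * R) := by gcongr
    _ = C * 2 ^ p * Real.exp (a * R) * w.im ^ (-p) := by ring

/-- Bound for the `x`-derivative pairing: `‖∫ u(x + iy) ψ'(x) dx‖ ≤ C 2^p e^{aR} y^{-p} ∫ ‖ψ'‖` for
`0 < y ≤ 1/2` when `ψ` is supported in `[-R, R]`. [folklore] -/
theorem norm_integral_mul_deriv_le {u : ℂ → ℂ} {C a p R : ℝ} (hC : 0 ≤ C) (ha : 0 ≤ a) (hp : 0 ≤ p)
    (hb : ∀ w : ℂ, 0 < w.im → w.im < 1 →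
      ‖u w‖ ≤ C * w.im ^ (-p) * (1 - w.im) ^ (-p) * Real.exp (a * |w.re|))
    {ψ : ℝ → ℂ} (hψ : ContDiff ℝ (⊤ : ℕ∞) ψ) (hψR : tsupport ψ ⊆ Icc (-R) R)
    {y : ℝ} (hy0 : 0 < y) (hy1 : y ≤ 1 / 2) :
    ‖∫ x : ℝ, u (x + y * I) * deriv ψ x‖ ≤
      C * 2 ^ p * Real.exp (a * R) * y ^ (-p) * ∫ x : ℝ, ‖deriv ψ x‖ := by
  have hsupp : tsupport (deriv ψ) ⊆ Icc (-R) R := tsupport_deriv_subset.trans hψR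
  have hψ'c : HasCompactSupport (deriv ψ) :=
    IsCompact.of_isClosed_subset isCompact_Icc (isClosed_tsupport _) hsupp
  have hψ'cont : Continuous (deriv ψ) := (hψ.continuous_deriv (by simp))
  have hint : Integrable (fun x => ‖deriv ψ x‖) :=
    (hψ'cont.integrable_of_hasCompactSupport hψ'c).norm
  rw [← integral_const_mul]
  refine norm_integral_le_of_norm_le (hint.const_mul _) (Filter.Eventually.of_forall fun x => ?_)
  by_cases hx : x ∈ tsupport (deriv ψ)
  · have hxR : |x| ≤ R := abs_le.mpr (by simpa using hsupp hx)
    rw [norm_mul]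
    have := norm_le_of_strip_growth_lower (w := x + y * I) hC ha hp hb (by simpa using hy0)
      (by simpa using hy1) (by simpa using hxR)
    simp only [add_im, ofReal_im, mul_im, ofReal_re, I_im, mul_one, I_re, mul_zero, add_zero,
      zero_add] at this
    exact mul_le_mul_of_nonneg_right this (norm_nonneg _)
  · have : deriv ψ x = 0 := image_eq_zero_of_notMem_tsupport hx
    simp [this]

/-- **Rate of convergence at the bottom line.** With `K = C 2^p e^{aR} N / (1 - p)`, where `N ≥ ∫ ‖ψ'‖` and
`ψ` is supported in `[-R, R]`: `‖Φ(y') - Φ(y)‖ ≤ K (y'^{1-p} - y^{1-p})` for `0 < y ≤ y' ≤ 1/2`, where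
`Φ(y) = ∫ u(x + iy) ψ(x) dx` (integrate `‖Φ'(t)‖ ≤ C 2^p e^{aR} N t^{-p}`). In particular `Φ` is Cauchy as
`y → 0⁺` when `p < 1`. [folklore] -/
theorem norm_stripPairing_sub_le {u : ℂ → ℂ} {C a p R N : ℝ} (hC : 0 ≤ C) (ha : 0 ≤ a) (hp : 0 ≤ p)
    (hp1 : p < 1)
    (hd : DifferentiableOn ℂ u {w : ℂ | 0 < w.im ∧ w.im < 1})
    (hb : ∀ w : ℂ, 0 < w.im → w.im < 1 →
      ‖u w‖ ≤ C * w.im ^ (-p) * (1 - w.im) ^ (-p) * Real.exp (a * |w.re|))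
    {ψ : ℝ → ℂ} (hψ : ContDiff ℝ (⊤ : ℕ∞) ψ) (hψR : tsupport ψ ⊆ Icc (-R) R)
    (hN : ∫ x : ℝ, ‖deriv ψ x‖ ≤ N)
    {y y' : ℝ} (hy0 : 0 < y) (hyy' : y ≤ y') (hy1 : y' ≤ 1 / 2) :
    ‖(∫ x : ℝ, u (x + y' * I) * ψ x) - ∫ x : ℝ, u (x + y * I) * ψ x‖ ≤
      C * 2 ^ p * Real.exp (a * R) * N / (1 - p) * (y' ^ (1 - p) - y ^ (1 - p)) := by
  have hψc : HasCompactSupport ψ :=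
    IsCompact.of_isClosed_subset isCompact_Icc (isClosed_tsupport _) hψR
  set Φ : ℝ → ℂ := fun y : ℝ => ∫ x : ℝ, u (x + y * I) * ψ x with hΦ
  set K₀ : ℝ := C * 2 ^ p * Real.exp (a * R) * N with hK₀
  have hK₀nn : 0 ≤ K₀ := by
    have : 0 ≤ N := le_trans (integral_nonneg fun x => norm_nonneg _) hN
    positivity
  set K : ℝ := K₀ / (1 - p) with hK
  have h1p : 0 < 1 - p := by linarith
  -- apply the ODE comparison lemma on `[y, y']`
  have hderiv : ∀ t ∈ Ico y y', HasDerivWithinAt (fun t => Φ t - Φ y)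
      (-I * ∫ x : ℝ, u (x + t * I) * deriv ψ x) (Ici t) t := by
    intro t ht
    have ht' : t ∈ Ioo (0:ℝ) 1 := ⟨by linarith [ht.1], by linarith [ht.2]⟩
    exact ((hasDerivAt_stripPairing hd hψ hψc ht').sub_const (Φ y)).hasDerivWithinAt
  have hcont : ContinuousOn (fun t => Φ t - Φ y) (Icc y y') := by
    refine ContinuousOn.sub ?_ continuousOn_const
    exact (continuousOn_stripPairing hd hψ hψc).mono fun t ht => ⟨by linarith [ht.1], by linarith [ht.2]⟩
  have hB : ContinuousOn (fun t : ℝ => K * (t ^ (1 - p) - y ^ (1 - p))) (Icc y y') := by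
    refine continuousOn_const.mul (ContinuousOn.sub ?_ continuousOn_const)
    exact continuousOn_id.rpow_const fun x _ => Or.inr h1p.le
  have hBderiv : ∀ t ∈ Ico y y', HasDerivWithinAt (fun t : ℝ => K * (t ^ (1 - p) - y ^ (1 - p)))
      (K * ((1 - p) * t ^ (1 - p - 1))) (Ici t) t := by
    intro t ht
    have ht0 : 0 < t := by linarith [ht.1]
    exact (((Real.hasDerivAt_rpow_const (Or.inl ht0.ne')).sub_const _).const_mul K).hasDerivWithinAt
  have hbound : ∀ t ∈ Ico y y', ‖-I * ∫ x : ℝ, u (x + t * I) * deriv ψ x‖ ≤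
      K * ((1 - p) * t ^ (1 - p - 1)) := by
    intro t ht
    have ht0 : 0 < t := by linarith [ht.1]
    have ht1 : t ≤ 1 / 2 := by linarith [ht.2]
    rw [norm_mul, norm_neg, norm_I, one_mul]
    calc ‖∫ x : ℝ, u (x + t * I) * deriv ψ x‖
        ≤ C * 2 ^ p * Real.exp (a * R) * t ^ (-p) * ∫ x : ℝ, ‖deriv ψ x‖ :=
          norm_integral_mul_deriv_le hC ha hp hb hψ hψR ht0 ht1
      _ ≤ C * 2 ^ p * Real.exp (a * R) * t ^ (-p) * N := by
          refine mul_le_mul_of_nonneg_left hN ?_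
          have : 0 ≤ t ^ (-p) := Real.rpow_nonneg ht0.le _
          positivity
      _ = K * ((1 - p) * t ^ (1 - p - 1)) := by
          rw [hK, hK₀, show (1 - p - 1 : ℝ) = -p by ring]
          field_simp
  have h0 : ‖Φ y - Φ y‖ ≤ K * (y ^ (1 - p) - y ^ (1 - p)) := by simp
  have := image_norm_le_of_norm_deriv_right_le_deriv_boundary' hcont hderiv h0 hB hBderiv hbound
    (right_mem_Icc.mpr hyy')
  simpa only [hΦ, hK, hK₀] using this

/-- **Existence of the weak boundary values** `lim_{y → 0⁺} ∫ u(x + iy) ψ(x) dx` for every smooth compactly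
supported `ψ`, for `u` holomorphic on the strip with `‖u‖ ≤ C y^{-p}(1-y)^{-p} e^{a|x|}`, `p < 1`
(Hörmander, *ALPDO I*, Thm. 3.1.15 with `N = 1`, the tree's
`Literature.Analysis.Distribution.tendsto_integral_of_norm_le_inv_pow`). [cite: HormanderALPDO1, Thm 3.1.15] -/
theorem exists_tendsto_stripPairing {u : ℂ → ℂ} {C a p : ℝ} (hC : 0 ≤ C) (ha : 0 ≤ a) (hp : 0 ≤ p)
    (hp1 : p ≤ 1)
    (hd : DifferentiableOn ℂ u {w : ℂ | 0 < w.im ∧ w.im < 1})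
    (hb : ∀ w : ℂ, 0 < w.im → w.im < 1 →
      ‖u w‖ ≤ C * w.im ^ (-p) * (1 - w.im) ^ (-p) * Real.exp (a * |w.re|))
    {ψ : ℝ → ℂ} (hψ : ContDiff ℝ (⊤ : ℕ∞) ψ) (hψc : HasCompactSupport ψ) :
    ∃ ℓ : ℂ, Tendsto (fun y : ℝ => ∫ x : ℝ, u (x + y * I) * ψ x) (𝓝[>] 0) (𝓝 ℓ) := by
  have hU : IsOpen {w : ℂ | 0 < w.im ∧ w.im < 1} :=
    (isOpen_Ioo (a := (0:ℝ)) (b := 1)).preimage continuous_im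
  obtain ⟨R, hR⟩ : ∃ R : ℝ, tsupport ψ ⊆ Icc (-R) R := by
    obtain ⟨R, hR⟩ := hψc.isCompact.isBounded.subset_closedBall 0
    exact ⟨R, fun x hx => by simpa [Real.closedBall_eq_Icc] using hR hx⟩
  have hX : tsupport ψ ⊆ Ioo (-(R + 1)) (R + 1) :=
    hR.trans fun x hx => ⟨by linarith [hx.1], by linarith [hx.2]⟩
  have key := Literature.Analysis.Distribution.tendsto_integral_of_norm_le_inv_pow (V := ℝ) (E := ℂ)
    (μ := volume) (J := ofRealCLM) (f := u) hU hd (X := Ioo (-(R + 1)) (R + 1)) (Γ := Ioi 0)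
    isOpen_Ioi (convex_Ioi 0) (fun c hc y hy => by simpa using mul_pos hc hy) (by simp)
    (γ := 1 / 2) (by norm_num)
    (fun x _ y hy hy' => ⟨by simpa using hy, by
      have : |y| < 1 / 2 := by simpa [Real.norm_eq_abs] using hy'
      have h2 := (abs_lt.mp this).2
      simp only [add_im, ofRealCLM_apply, ofReal_im, smul_eq_mul, mul_im, I_re, I_im,
        ofReal_re, zero_mul, one_mul, zero_add]
      linarith⟩)
    (C := C * 2 ^ p * Real.exp (a * (R + 1))) (N := 1) ?_ hψ hψc hX
  · obtain ⟨ℓ, hℓ⟩ := key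
    refine ⟨ℓ, ?_⟩
    have e : (fun y : ℝ => ∫ x : ℝ, ψ x * u (ofRealCLM x + I • ofRealCLM y)) =
        fun y : ℝ => ∫ x : ℝ, u (x + y * I) * ψ x := by
      funext y; congr 1; funext x
      simp only [ofRealCLM_apply, smul_eq_mul]; ring_nf
    rw [e] at hℓ
    exact hℓ
  · intro x hx y hy hy'
    have hy0 : 0 < y := hy
    have hy2 : y < 1 / 2 := by
      have : |y| < 1 / 2 := by simpa [Real.norm_eq_abs] using hy'
      exact (abs_lt.mp this).2
    have hxR : |x| ≤ R + 1 := abs_le.mpr ⟨by linarith [hx.1], by linarith [hx.2]⟩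
    have h1 := norm_le_of_strip_growth_lower (w := ofRealCLM x + I • ofRealCLM y) hC ha hp hb
      (by simpa using hy0) (by simp; linarith) (by simpa using hxR)
    have him : (ofRealCLM x + I • ofRealCLM y).im = y := by simp
    rw [him] at h1
    refine h1.trans ?_
    rw [pow_one, Real.norm_eq_abs, abs_of_pos hy0]
    refine mul_le_mul_of_nonneg_left ?_ (by positivity)
    rw [Real.rpow_neg hy0.le, ← Real.inv_rpow hy0.le]
    have h1y : 1 ≤ y⁻¹ := one_le_inv_iff₀.mpr ⟨hy0, by linarith⟩
    calc y⁻¹ ^ p ≤ y⁻¹ ^ (1:ℝ) := Real.rpow_le_rpow_of_exponent_le h1y hp1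
      _ = y⁻¹ := Real.rpow_one _

/-- **Rate at the bottom line for the limit:** if `∫ u(x + iy) ψ(x) dx → ℓ` as `y → 0⁺`, then
`‖∫ u(x + iy') ψ(x) dx - ℓ‖ ≤ K y'^{1-p}` for `0 < y' ≤ 1/2`, `K = C 2^p e^{aR} N / (1 - p)` as in
`norm_stripPairing_sub_le`. [folklore] -/
theorem norm_stripPairing_sub_lim_le {u : ℂ → ℂ} {C a p R N : ℝ} (hC : 0 ≤ C) (ha : 0 ≤ a) (hp : 0 ≤ p)
    (hp1 : p < 1)
    (hd : DifferentiableOn ℂ u {w : ℂ | 0 < w.im ∧ w.im < 1})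
    (hb : ∀ w : ℂ, 0 < w.im → w.im < 1 →
      ‖u w‖ ≤ C * w.im ^ (-p) * (1 - w.im) ^ (-p) * Real.exp (a * |w.re|))
    {ψ : ℝ → ℂ} (hψ : ContDiff ℝ (⊤ : ℕ∞) ψ) (hψR : tsupport ψ ⊆ Icc (-R) R)
    (hN : ∫ x : ℝ, ‖deriv ψ x‖ ≤ N) {ℓ : ℂ}
    (hℓ : Tendsto (fun y : ℝ => ∫ x : ℝ, u (x + y * I) * ψ x) (𝓝[>] 0) (𝓝 ℓ))
    {y' : ℝ} (hy0 : 0 < y') (hy1 : y' ≤ 1 / 2) :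
    ‖(∫ x : ℝ, u (x + y' * I) * ψ x) - ℓ‖ ≤
      C * 2 ^ p * Real.exp (a * R) * N / (1 - p) * y' ^ (1 - p) := by
  set K : ℝ := C * 2 ^ p * Real.exp (a * R) * N / (1 - p) with hK
  have hKnn : 0 ≤ K := by
    have : 0 ≤ N := le_trans (integral_nonneg fun x => norm_nonneg _) hN
    have : 0 < 1 - p := by linarith
    positivity
  have hlim : Tendsto (fun y : ℝ => ‖(∫ x : ℝ, u (x + y' * I) * ψ x) - ∫ x : ℝ, u (x + y * I) * ψ x‖)
      (𝓝[>] 0) (𝓝 ‖(∫ x : ℝ, u (x + y' * I) * ψ x) - ℓ‖) :=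
    (tendsto_const_nhds.sub hℓ).norm
  refine le_of_tendsto hlim ?_
  filter_upwards [Ioc_mem_nhdsGT hy0] with y hy
  calc ‖(∫ x : ℝ, u (x + y' * I) * ψ x) - ∫ x : ℝ, u (x + y * I) * ψ x‖
      ≤ K * (y' ^ (1 - p) - y ^ (1 - p)) :=
        norm_stripPairing_sub_le hC ha hp hp1 hd hb hψ hψR hN hy.1 hy.2 hy1
    _ ≤ K * y' ^ (1 - p) := by
        refine mul_le_mul_of_nonneg_left ?_ hKnn
        linarith [Real.rpow_nonneg hy.1.le (1 - p)]

end Literature.Analysis.Complex
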